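import Literature.Probability.Percolation.TwoSetExchange
import Literature.Probability.LatticeModels.SahiThirdOrderCorrelation
import Literature.Probability.LatticeModels.ProdBernoulliWeightContinuity
import HarnessLib

/-!
# The BHK-typed third-order hypothesis of `…FrontierDecRowsTypedBHK3` is FALSE (a two-vertex witness)

Support file (`--supports stmt-CriticalPhenomena-4575`; lead `prim-nh-lead-4575` gen 58, INEQ-CLAIMS block 2026-08-20T23:27Z,
memo `run/shared/lean/prim/prim-nh-lead-4575/FROM-prim-nh-lead-4575-g58-ANSWER-CONJECTURE-G.md`).  No definitions, no named facts,
no sorries, no `native_decide`.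

`…Theorems/PercNearOneGluingNoHeavyLowerTailFrontierDecRowsTypedBHK3.lean` (prover `prim-ineq-prove-3` gen 10, p240166) reduces the
open "dec rows" 36 / 44 / 15 of the four-point cubic frontier to the hypothesis ("conjecture G, typed third-order BHK")

  `hG (n, w)`: for all `S T : Set (Fin n)` and all events `A` of BHK type `(+)` — closed under enlarging `C_S = ⋃_{s ∈ S} C_s`
  (`openEdgeCluster`) and shrinking `C_T` — and `B` of type `(−)`:  `0 ≤ E₃({S ↮ T}, Aᶜ, Bᶜ)` under `prodBernoulli w`,

with the tree's `sahiE3 μ X Y Z = 2μ(X∩Y∩Z) + μXμYμZ − (μX μ(Y∩Z) + μY μ(X∩Z) + μZ μ(X∩Y))`.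

**This hypothesis is unsatisfiable** as soon as some pair `a ≠ b` has `0 < P(a ~ b) < 1` (`typedBHK3_hypothesis_false_of_prob`),
in particular for every weight function with all weights in `(0,1)` on `n ≥ 2` vertices (`typedBHK3_hypothesis_false`) and for the
single edge `K₂` at `p = 1/2` (`typedBHK3_hypothesis_false_fin_two`, where `E₃ = −1/8`).  WITNESS: `S = {a}`, `T = {b}`,
`A = {b ↮ a}` — of type `(+)` by the tree's own `TwoSetExchange.typePlus_not_openConn_of_mem` — and `B = {a ↮ b}` — of type `(−)`
by `TwoSetExchange.typeMinus_not_openConn_of_mem`.  Then `{S ↮ T} = {a ↮ b}`, `Aᶜ = Bᶜ = X := {a ~ b}` and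
`E₃(Xᶜ, X, X) = (1 − x)x² − (1 − x)x = −x(1 − x)² < 0` (`sahiE3_compl_self_self`).  The mechanism: BHK's types admit events that
are DECREASING in the configuration (here `{t ↮ v}` and `{S ↮ T}` itself), for which the "Harris drops" in prim-ineq-prove-3's
conditional-Harris decomposition have the wrong sign; the memo's intended conjecture ("G⁺": `A`, `B` increasing events, increasing
functions of `C_S`, `C_T`) is NOT touched by this file and is recorded as an open conjectural row of the INEQ-CLAIMS table.
Consequently the three theorems `frontier_36/44/15_of_typedBHK3` are conditionals on a refutable hypothesis (vacuous as stated);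
re-stated with `IsUpperSet A → IsUpperSet B →` added they are meaningful reductions.

* `sahiE3_compl_self_self` — `E₃(Xᶜ, X, X) = −(μX · (1 − μX)²)` for a probability measure.
* `typedBHK3_hypothesis_false_of_prob`, `typedBHK3_hypothesis_false`, `typedBHK3_hypothesis_false_fin_two` — the refutations.
-/

noncomputable section

namespace Summit.CriticalPhenomena.PercolationContinuityZ3.Theorems.FrontierDecRows

open MeasureTheory
open Literature.Probability.Percolation Literature.Probability.LatticeModels
open Literature.Probability.Percolation.TwoSetExchange

/-- `E₃(Xᶜ, X, X) = −μ(X)(1 − μ(X))²` for a probability measure and a measurable event `X`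
(`Xᶜ ∩ X = ∅`, `μ(Xᶜ) = 1 − μ(X)`). [this work] -/
theorem sahiE3_compl_self_self {Ω : Type*} [MeasurableSpace Ω] (μ : Measure Ω) [IsProbabilityMeasure μ]
    {X : Set Ω} (hX : MeasurableSet X) :
    sahiE3 μ Xᶜ X X = -(μ.real X * (1 - μ.real X) ^ 2) := by
  rw [sahiE3_def, Set.compl_inter_self, Set.empty_inter, Set.inter_self, measureReal_empty,
    probReal_compl_eq_one_sub hX]
  ring

variable {n : ℕ}

/-- **The typed third-order BHK hypothesis fails whenever some pair is connected with probability strictly between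
`0` and `1`.**  For `a b : Fin n` with `0 < P(a ~ b) < 1` under `prodBernoulli w`, the hypothesis `hG (n, w)` of
`frontier_36/44/15_of_typedBHK3` (quantified over ALL `S, T` and all BHK-typed `A, B`) is false: instantiate
`S = {a}, T = {b}, A = {b ↮ a}, B = {a ↮ b}`. [this work] -/
theorem typedBHK3_hypothesis_false_of_prob (w : Sym2 (Fin n) → unitInterval) (a b : Fin n)
    (h0 : 0 < (prodBernoulli w).real (openConn a b : Set (BondConfig (Fin n))))
    (h1 : (prodBernoulli w).real (openConn a b : Set (BondConfig (Fin n))) < 1) :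
    ¬ (∀ (S T : Set (Fin n)) (A B : Set (BondConfig (Fin n))),
      (∀ ⦃ω ω' : BondConfig (Fin n)⦄, (⋃ s ∈ S, openEdgeCluster ω s) ⊆ (⋃ s ∈ S, openEdgeCluster ω' s) →
        (⋃ t ∈ T, openEdgeCluster ω' t) ⊆ (⋃ t ∈ T, openEdgeCluster ω t) → ω ∈ A → ω' ∈ A) →
      (∀ ⦃ω ω' : BondConfig (Fin n)⦄, (⋃ s ∈ S, openEdgeCluster ω' s) ⊆ (⋃ s ∈ S, openEdgeCluster ω s) →
        (⋃ t ∈ T, openEdgeCluster ω t) ⊆ (⋃ t ∈ T, openEdgeCluster ω' t) → ω ∈ B → ω' ∈ B) →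
      0 ≤ sahiE3 (prodBernoulli w) {ω : BondConfig (Fin n) | ∀ s ∈ S, ∀ t ∈ T, ¬ (openGraph ω).Reachable s t} Aᶜ Bᶜ) := by
  intro hG
  -- the witness: S = {a}, T = {b}, A = {b ↮ a} (type (+)), B = {a ↮ b} (type (−))
  have hA := typePlus_not_openConn_of_mem ({a} : Set (Fin n)) ({b} : Set (Fin n))
    (t₀ := b) (Set.mem_singleton b) a
  have hB := typeMinus_not_openConn_of_mem ({a} : Set (Fin n)) ({b} : Set (Fin n))
    (s₀ := a) (Set.mem_singleton a) b
  have h := hG {a} {b} (openConn b a : Set (BondConfig (Fin n)))ᶜ (openConn a b : Set (BondConfig (Fin n)))ᶜ hA hB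
  -- identify the three events with Xᶜ, X, X for X = {a ~ b}
  have hD : {ω : BondConfig (Fin n) | ∀ s ∈ ({a} : Set (Fin n)), ∀ t ∈ ({b} : Set (Fin n)),
      ¬ (openGraph ω).Reachable s t} = (openConn a b : Set (BondConfig (Fin n)))ᶜ := by
    ext ω
    simp only [Set.mem_singleton_iff, forall_eq, Set.mem_setOf_eq, Set.mem_compl_iff, openConn]
  have hba : (openConn b a : Set (BondConfig (Fin n))) = openConn a b := by
    ext ω
    exact ⟨fun h' => SimpleGraph.Reachable.symm h', fun h' => SimpleGraph.Reachable.symm h'⟩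
  rw [hD, compl_compl, compl_compl, hba,
    sahiE3_compl_self_self (prodBernoulli w) MeasurableSet.of_discrete] at h
  -- −x(1−x)² < 0
  have hx1 : 0 < 1 - (prodBernoulli w).real (openConn a b : Set (BondConfig (Fin n))) := sub_pos.2 h1
  nlinarith [mul_pos h0 (mul_pos hx1 hx1)]

/-- **The typed hypothesis fails for every non-degenerate weight function on at least two vertices.**
If every edge weight lies in `(0,1)` and `a ≠ b`, then `0 < P(a ~ b) < 1` (the all-open configuration joins `a` to `b`,
the all-closed one separates them, and both have positive probability), so `typedBHK3_hypothesis_false_of_prob`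
applies. [this work] -/
theorem typedBHK3_hypothesis_false (w : Sym2 (Fin n) → unitInterval) (hw : ∀ e, 0 < w e ∧ w e < 1)
    {a b : Fin n} (hab : a ≠ b) :
    ¬ (∀ (S T : Set (Fin n)) (A B : Set (BondConfig (Fin n))),
      (∀ ⦃ω ω' : BondConfig (Fin n)⦄, (⋃ s ∈ S, openEdgeCluster ω s) ⊆ (⋃ s ∈ S, openEdgeCluster ω' s) →
        (⋃ t ∈ T, openEdgeCluster ω' t) ⊆ (⋃ t ∈ T, openEdgeCluster ω t) → ω ∈ A → ω' ∈ A) →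
      (∀ ⦃ω ω' : BondConfig (Fin n)⦄, (⋃ s ∈ S, openEdgeCluster ω' s) ⊆ (⋃ s ∈ S, openEdgeCluster ω s) →
        (⋃ t ∈ T, openEdgeCluster ω t) ⊆ (⋃ t ∈ T, openEdgeCluster ω' t) → ω ∈ B → ω' ∈ B) →
      0 ≤ sahiE3 (prodBernoulli w) {ω : BondConfig (Fin n) | ∀ s ∈ S, ∀ t ∈ T, ¬ (openGraph ω).Reachable s t} Aᶜ Bᶜ) := by
  -- `P(a ~ b) > 0`: the all-open configuration is in `{a ~ b}`
  have hmem : (Set.univ : BondConfig (Fin n)) ∈ (openConn a b : Set (BondConfig (Fin n))) := by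
    change (openGraph (Set.univ : BondConfig (Fin n))).Reachable a b
    refine SimpleGraph.Adj.reachable ?_
    rw [openGraph_adj]
    exact ⟨Set.mem_univ _, hab⟩
  have h0 : 0 < (prodBernoulli w).real (openConn a b : Set (BondConfig (Fin n))) :=
    prodBernoulli_real_pos_of_nonempty hw ⟨Set.univ, hmem⟩
  -- `P(a ≁ b) > 0`: the all-closed configuration is in `{a ≁ b}`
  have hmem' : (∅ : BondConfig (Fin n)) ∈ (openConn a b : Set (BondConfig (Fin n)))ᶜ := by
    intro h
    change (openGraph (∅ : BondConfig (Fin n))).Reachable a b at h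
    have hbot : openGraph (∅ : BondConfig (Fin n)) = ⊥ := by
      ext x y
      simp only [openGraph_adj, Set.mem_empty_iff_false, false_and, SimpleGraph.bot_adj]
    rw [hbot] at h
    exact hab (SimpleGraph.reachable_bot.1 h)
  have h0' : 0 < (prodBernoulli w).real (openConn a b : Set (BondConfig (Fin n)))ᶜ :=
    prodBernoulli_real_pos_of_nonempty hw ⟨∅, hmem'⟩
  have h1 : (prodBernoulli w).real (openConn a b : Set (BondConfig (Fin n))) < 1 := by
    rw [probReal_compl_eq_one_sub MeasurableSet.of_discrete] at h0'
    linarith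
  exact typedBHK3_hypothesis_false_of_prob w a b h0 h1

/-- **Concrete instance: the single edge `K₂` at `p = 1/2`.**  On `Fin 2` with every weight `1/2` the typed hypothesis is false
(the witness evaluates to `E₃ = −1/8`). [this work] -/
theorem typedBHK3_hypothesis_false_fin_two :
    ¬ (∀ (S T : Set (Fin 2)) (A B : Set (BondConfig (Fin 2))),
      (∀ ⦃ω ω' : BondConfig (Fin 2)⦄, (⋃ s ∈ S, openEdgeCluster ω s) ⊆ (⋃ s ∈ S, openEdgeCluster ω' s) →
        (⋃ t ∈ T, openEdgeCluster ω' t) ⊆ (⋃ t ∈ T, openEdgeCluster ω t) → ω ∈ A → ω' ∈ A) →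
      (∀ ⦃ω ω' : BondConfig (Fin 2)⦄, (⋃ s ∈ S, openEdgeCluster ω' s) ⊆ (⋃ s ∈ S, openEdgeCluster ω s) →
        (⋃ t ∈ T, openEdgeCluster ω t) ⊆ (⋃ t ∈ T, openEdgeCluster ω' t) → ω ∈ B → ω' ∈ B) →
      0 ≤ sahiE3 (prodBernoulli fun _ : Sym2 (Fin 2) => Literature.Probability.Percolation.half)
        {ω : BondConfig (Fin 2) | ∀ s ∈ S, ∀ t ∈ T, ¬ (openGraph ω).Reachable s t} Aᶜ Bᶜ) := by
  refine typedBHK3_hypothesis_false (fun _ : Sym2 (Fin 2) => Literature.Probability.Percolation.half)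
    (fun _ => ⟨?_, ?_⟩) (a := 0) (b := 1) (by decide)
  · exact unitInterval.coe_pos.1 (by rw [coe_half]; norm_num)
  · exact unitInterval.coe_lt_one.1 (by rw [coe_half]; norm_num)

end Summit.CriticalPhenomena.PercolationContinuityZ3.Theorems.FrontierDecRows
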